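import Literature.Analysis.FluidPDE.NSLerayHopfSereginStability
import Literature.Analysis.FluidPDE.JiaSverak2013Compactness
import Literature.Analysis.FluidPDE.HomSobolevRepresentedL3
import Literature.Analysis.FluidPDE.LocalLerayWeakStrongViscosity
import Literature.Analysis.FunctionSpaces.TestPairingLimits
import HarnessLib

/-!
# Rusin–Šverák's weak stability of `NS(u₀)` (**K**, `Ḣ^{1/2}` data) from its `L³` twin **K₃**
(Jia–Šverák 2013): proof of the reduction `K₃ → K`, and **S**, Cor. 4.2, Cor. 4.3 over **K₃**

Analysis/FluidPDE proof file (no new definitions, no new named facts) for the named fact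
**K** `Literature.Analysis.FluidPDE.rusin_sverak_leray_weak_stability`
(`RusinSverakLerayStability.lean`; Rusin–Šverák, J. Funct. Anal. 260 (2011) 879–891 =
arXiv:0911.0500, **Thm. 4.2** p. 7 with **Lemma 4.1** and **Prop. 2.2**: from Leray solutions
`(u^k, p^k) ∈ NS(v₀^k)` whose data are bounded and weakly convergent in `Ḣ^{1/2}` one extracts a
subsequence converging, with renormalised pressures, in "the situation of Prop. 2.2" on
`(0, ∞) × ℝ³` to a Leray solution `(u, p) ∈ NS(v_∞)` of the weak limit datum).

**Triage.** Against Mathlib and the tree, **K** is a theory, not a lemma: Lemma 4.1 is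
Lemarié-Rieusset's a priori estimate for local Leray solutions (*Recent developments in the
Navier–Stokes problem* (2002), Prop. 32.1 and Lemma 32.2, with the pressure renormalisation
`p - p_{x₀,r}(t)`), Prop. 2.2 is the Aubin–Lions / Rellich–Lions compactness of suitable weak
solutions with Calderón–Zygmund control of the pressure and the passage to the limit in the local
energy inequality, and the proof of Thm. 4.2 proper identifies the initial datum of the limit
("(a) the equation implies that `u(t) → u₀` weakly in `L²` on compact subsets as `t → 0` and (b)
inequality (4.8) implies that … `limsup_{t→0₊} ‖u(t)ψ‖ ≤ ‖u₀ψ‖`", p. 8). None of these is in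
Mathlib, and in the tree each is (part of) an undischarged named fact.

**What is proved here.** The tree already holds the *same* compactness statement for `L³` data —
the named fact **K₃** `jia_sverak_leray_weak_stability` (`NSLerayHopfSereginStability.lean`;
Jia–Šverák, SIAM J. Math. Anal. 45 (2013) = arXiv:1201.1592, proof of Thm. 1 with Cor. 1,
Lemma 5 (= Rusin–Šverák Prop. 2.2) and Lemma 8; Lemarié-Rieusset 2016, proof of Thm. 15.5,
pp. 570–571), vendored there as "the `L³` twin of the accepted **K**" and consumed by the
decomposition of Seregin's theorem. This file **proves `K₃ → K`**
(`rusin_sverak_leray_weak_stability_of_jia_sverak`), so that the two DAGs (Rusin–Šverák's minimal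
blow-up data, Cor. 4.2–4.3; Seregin's `L³` criterion) rest on the single leaf **K₃**. The proof is
the remark of note (1) of `RusinSverakLerayStability.lean`: data `v₀^k` represented by classes
`g_k ∈ Ḣ^{1/2}(ℝ³; ℂ³)` with `‖g_k‖ ≤ R` are bounded in `L³` by the tree's (discharged) Sobolev
embedding (`exists_eLpNorm_three_le_of_represents_of_norm_le`, `HomSobolevRepresentedL3.lean`;
Bahouri–Chemin–Danchin 2011, Thm. 1.38), so **K₃** applies with `M = C R`; its weak-`L³` limit
datum `a'` (`∫ ⟪v₀^{σ(k)}, φ⟫ → ∫ ⟪a', φ⟫` for all test fields `φ`) coincides a.e. with the field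
`v_∞` represented by the weak `Ḣ^{1/2}` limit `g_∞` of the `g_k` — weak `Ḣ^{1/2}` limits of
represented data are weak `L³` limits (`HomSobolev.Represents.tendsto_integral_mul_apply`,
`HomSobolevWeakLimits.lean`; Jia–Šverák 2013, proof of Thm. 1: "`u₀^k ⇀ u₀` in `L³`"), limits
in `ℝ` are unique, and a locally integrable field is determined by its pairings with test
functions (du Bois-Reymond; Mathlib `ae_eq_of_integral_contDiff_smul_eq`) — this is
`ae_eq_of_represents_of_tendsto_integral_inner`; and the datum of a local Leray solution may be
changed on a null set (`IsLocalLeraySolution.congr_datum`). The remaining clauses of **K₃**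
(weak continuity of the limit, convergence of traces) are not used.

Also restated over **K₃**: **S** (`rusin_sverak_leray_singular_points_stable`, Thm. 4.2 with
Lemma 2.1) from **K₃**, **L**, **B**; Cor. 4.2 (`rusin_sverak_weak_limit_of_singular_points`) and
both clauses of Cor. 4.3 (`rusin_sverak_minimal_data_compact`, `rusin_sverak_minimal_blowup`) over
the leaves of `RusinSverakLerayStability.lean` with **K** replaced by **K₃**.

State of the DAG below **K** after this file: **K** ⇐ **K₃** (proved here); **K₃** is the local
Leray compactness theory (Jia–Šverák 2013 Cor. 1 = Rusin–Šverák Lemma 4.1: a priori estimate;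
Lemma 5 = Prop. 2.2: compactness; Lemma 8 = proof of Thm. 4.2: attainment of the datum;
Kang–Miura–Tsai 2021 Lemmas 3.3–3.4: decay and weak continuity of the limit), undischarged, and
decomposed in `JiaSverak2013Compactness.lean` into the named facts **F1**
`jia_sverak_2013_corollary_1` (Cor. 1), **F3** `jia_sverak_2013_lemma_8` (Lemma 8) and **F2**
`localLeray_limiting_procedure` (the limiting procedure), with
`jia_sverak_leray_weak_stability_of_facts : F1 → F3 → F2 → K₃` proved there; composing,
`rusin_sverak_leray_weak_stability_of_facts : F1 → F3 → F2 → K` (this file) makes the trust base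
of **K** these three printed results.

## Mathlib / tree search

Tree: `jia_sverak_leray_weak_stability` (**K₃**), `rusin_sverak_leray_weak_stability` (**K**),
`rusin_sverak_leray_singular_points_stable_of_weak_stability`,
`rusin_sverak_weak_limit_of_singular_points_of_weak_stability`,
`rusin_sverak_minimal_data_compact_of_weak_stability`,
`rusin_sverak_minimal_blowup_of_weak_stability` (`RusinSverakLerayStability.lean`);
`exists_eLpNorm_three_le_of_represents_of_norm_le` (`HomSobolevRepresentedL3.lean`);
`HomSobolev.Represents.tendsto_integral_mul_apply` (`HomSobolevWeakLimits.lean`);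
`IsLocalLeraySolution.congr_datum` (`LocalLerayWeakStrongViscosity.lean`);
`isTestFunctionOn_smul_const` (`FunctionSpaces/TestPairingLimits.lean`);
`jia_sverak_leray_weak_stability_of_facts` (`JiaSverak2013Compactness.lean`). Mathlib:
`ae_eq_of_integral_contDiff_smul_eq`, `MemLp.locallyIntegrable`,
`ContinuousLinearMap.integrableAtFilter_comp`, `EuclideanSpace.inner_single_right`, `PiLp.ext`,
`tendsto_nhds_unique`. Nothing named `*_of_jia_sverak` existed (`lean search`).

## References

* W. Rusin, V. Šverák, *Minimal initial data for potential Navier–Stokes singularities*,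
  J. Funct. Anal. 260 (2011) 879–891 = arXiv:0911.0500: Prop. 2.2 (p. 4), Lemma 4.1, Thm. 4.2
  and its proof (pp. 7–8), Cor. 4.2, Cor. 4.3 (p. 8).
* H. Jia, V. Šverák, *Minimal `L³`-initial data for potential Navier–Stokes singularities*,
  SIAM J. Math. Anal. 45 (2013) = arXiv:1201.1592: Cor. 1, Lemmas 5–8, proof of Thm. 1.
* P. G. Lemarié-Rieusset, *The Navier–Stokes problem in the 21st century* (2016), proof of
  Thm. 15.5, pp. 570–571; *Recent developments in the Navier–Stokes problem* (2002), Prop. 32.1,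
  Lemma 32.2.
* H. Bahouri, J.-Y. Chemin, R. Danchin, *Fourier analysis and nonlinear PDE* (2011), Thm. 1.38.
* K. Kang, H. Miura, T.-P. Tsai, IMRN 2021 = arXiv:1812.10509, §3, Lemmas 3.3–3.5.
-/

noncomputable section

open MeasureTheory TopologicalSpace Filter Set Function Metric
open _root_.Topology
open scoped ENNReal NNReal InnerProductSpace ContDiff

namespace Literature.Analysis.FluidPDE

/-! ### Identification of the two weak limits of the data -/

/-- **Weak `Ḣ^{1/2}` limits and weak `L³` limits of the same data agree a.e.** Let
`g_n ⇀ g_∞` weakly in `Ḣ^{1/2}(ℝ³; ℂ³)`, `g_n` representing the real field `u_n` and `g_∞`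
representing the locally integrable real field `v`; if the pairings `∫ ⟪u_n, φ⟫` converge to
`∫ ⟪a, φ⟫` for every smooth compactly supported field `φ`, `a` locally integrable, then `a = v`
a.e. Proof: componentwise, `∫ θ (u_n)ᵢ → ∫ θ vᵢ` for real test functions `θ`
(`HomSobolev.Represents.tendsto_integral_mul_apply`: weak `Ḣ^{1/2}` limits of represented data
are distributional limits) and `∫ θ (u_n)ᵢ → ∫ θ aᵢ` (test field `θ • eᵢ`), so `∫ θ aᵢ = ∫ θ vᵢ`
by uniqueness of limits, and `aᵢ = vᵢ` a.e. by du Bois-Reymond (Mathlib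
`ae_eq_of_integral_contDiff_smul_eq`). This is the identification "`u₀^k ⇀ u₀` in `L³`" of the
weak `Ḣ^{1/2}` limit datum in Rusin–Šverák 2011, proof of Cor. 4.3 / Jia–Šverák 2013, proof of
Thm. 1. [folklore] -/
theorem ae_eq_of_represents_of_tendsto_integral_inner
    {gseq : ℕ → FunctionSpaces.HomSobolev (EuclideanSpace ℝ (Fin 3)) (EuclideanSpace ℂ (Fin 3))
      (1 / 2 : ℝ)}
    {glim : FunctionSpaces.HomSobolev (EuclideanSpace ℝ (Fin 3)) (EuclideanSpace ℂ (Fin 3))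
      (1 / 2 : ℝ)}
    (hw : ∀ w : FunctionSpaces.HomSobolev (EuclideanSpace ℝ (Fin 3)) (EuclideanSpace ℂ (Fin 3))
      (1 / 2 : ℝ), Tendsto (fun n => ⟪gseq n, w⟫_ℂ) atTop (𝓝 ⟪glim, w⟫_ℂ))
    {u : ℕ → EuclideanSpace ℝ (Fin 3) → EuclideanSpace ℝ (Fin 3)}
    (hseq : ∀ n, (gseq n).Represents (FunctionSpaces.EuclideanSpace.complexify ∘ u n))
    {v : EuclideanSpace ℝ (Fin 3) → EuclideanSpace ℝ (Fin 3)}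
    (hlim : glim.Represents (FunctionSpaces.EuclideanSpace.complexify ∘ v))
    (hv : LocallyIntegrable v volume) {a : EuclideanSpace ℝ (Fin 3) → EuclideanSpace ℝ (Fin 3)}
    (ha : LocallyIntegrable a volume)
    (hweak : ∀ φ : EuclideanSpace ℝ (Fin 3) → EuclideanSpace ℝ (Fin 3),
      FunctionSpaces.IsTestFunctionOn (⊤ : Opens (EuclideanSpace ℝ (Fin 3))) φ →
      Tendsto (fun n => ∫ x, ⟪u n x, φ x⟫_ℝ) atTop (𝓝 (∫ x, ⟪a x, φ x⟫_ℝ))) :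
    a =ᵐ[volume] v := by
  have hcomp : ∀ i : Fin 3, ∀ᵐ x ∂(volume : Measure (EuclideanSpace ℝ (Fin 3))),
      a x i = v x i := by
    intro i
    have hai : LocallyIntegrable (fun x => a x i) volume := fun x =>
      (EuclideanSpace.proj (𝕜 := ℝ) i).integrableAtFilter_comp (ha x)
    have hvi : LocallyIntegrable (fun x => v x i) volume := fun x =>
      (EuclideanSpace.proj (𝕜 := ℝ) i).integrableAtFilter_comp (hv x)
    refine ae_eq_of_integral_contDiff_smul_eq hai hvi fun θ hθ hθc => ?_
    -- the pairings with `θ • eᵢ` converge to both `∫ θ vᵢ` and `∫ θ aᵢ`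
    have h1 : Tendsto (fun n => ∫ x, θ x * u n x i) atTop (𝓝 (∫ x, θ x * v x i)) :=
      FunctionSpaces.HomSobolev.Represents.tendsto_integral_mul_apply hw hseq hlim hθ hθc i
    have key : ∀ f : EuclideanSpace ℝ (Fin 3) → EuclideanSpace ℝ (Fin 3),
        (fun x => ⟪f x, θ x • EuclideanSpace.single i (1 : ℝ)⟫_ℝ) = fun x => θ x * f x i := by
      intro f
      funext x
      rw [real_inner_smul_right, EuclideanSpace.inner_single_right, one_mul, RCLike.conj_to_real]
    have h2 : Tendsto (fun n => ∫ x, θ x * u n x i) atTop (𝓝 (∫ x, θ x * a x i)) := by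
      have h := hweak (fun x => θ x • EuclideanSpace.single i (1 : ℝ))
        (FunctionSpaces.isTestFunctionOn_smul_const hθ hθc _)
      simpa only [key] using h
    have h3 := tendsto_nhds_unique h2 h1
    simpa only [smul_eq_mul] using h3
  filter_upwards [ae_all_iff.2 hcomp] with x hx
  exact PiLp.ext hx

/-! ### `K₃ → K` -/

/-- **Rusin–Šverák's weak stability of `NS(u₀)` for `Ḣ^{1/2}`-bounded data (the named fact K,
Thm. 4.2 with Lemma 4.1 and Prop. 2.2) from its `L³` form K₃ (Jia–Šverák 2013, proof of Thm. 1
with Cor. 1, Lemma 5, Lemma 8).** Data `v₀^k` represented by `g_k ∈ Ḣ^{1/2}` with `‖g_k‖ ≤ R`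
are bounded in `L³` (`exists_eLpNorm_three_le_of_represents_of_norm_le`, the Sobolev embedding
`Ḣ^{1/2} ↪ L³`), so **K₃** extracts a subsequence `σ`, renormalised pressures `q_k`, a weak-`L³`
limit datum `a'` and `(U, P) ∈ 𝒩(a')` in the situation of Prop. 2.2; the weak `Ḣ^{1/2}` limit
`g_∞` of the `g_{σ(k)}` represents `v_∞`, hence `a' = v_∞` a.e.
(`ae_eq_of_represents_of_tendsto_integral_inner`), and `(U, P) ∈ 𝒩(v_∞)`
(`IsLocalLeraySolution.congr_datum`).
[cite: RusinSverak2011, Thm. 4.2 with Lemma 4.1 and Prop. 2.2 (arXiv:0911.0500 pp. 4, 7)] -/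
theorem rusin_sverak_leray_weak_stability_of_jia_sverak (hK₃ : jia_sverak_leray_weak_stability) :
    rusin_sverak_leray_weak_stability := by
  intro v₀ g u p hdata hbdd hleray glim hweak vlim hv3 hvrep _
  obtain ⟨M, hM⟩ :=
    exists_eLpNorm_three_le_of_represents_of_norm_le (fun k => (hdata k).2.1) hbdd
  obtain ⟨σ, a', U, P, q, hσ, ha'3, -, -, hweak', hU, hsit, -, -⟩ :=
    hK₃ M v₀ u p (fun k => ⟨(hdata k).1, (hdata k).2.2, hM k⟩) hleray
  have hσw : ∀ w : FunctionSpaces.HomSobolev (EuclideanSpace ℝ (Fin 3))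
      (EuclideanSpace ℂ (Fin 3)) (1 / 2 : ℝ),
      Tendsto (fun n => ⟪g (σ n), w⟫_ℂ) atTop (𝓝 ⟪glim, w⟫_ℂ) := fun w =>
    (hweak w).comp hσ.tendsto_atTop
  have hae : a' =ᵐ[volume] vlim :=
    ae_eq_of_represents_of_tendsto_integral_inner hσw (fun n => (hdata (σ n)).2.1) hvrep
      (hv3.locallyIntegrable (by norm_num)) (ha'3.locallyIntegrable (by norm_num)) hweak'
  exact ⟨σ, hσ, U, P, q, hU.congr_datum hae.symm, hsit⟩

/-- **K from Jia–Šverák's Cor. 1, Lemma 8 and the limiting procedure** (the leaves **F1**,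
**F3**, **F2** of `JiaSverak2013Compactness.lean`): `jia_sverak_leray_weak_stability_of_facts`
(F1 → F3 → F2 → K₃, the printed proof of Jia–Šverák's Thm. 1) composed with
`rusin_sverak_leray_weak_stability_of_jia_sverak` (K₃ → K). After this theorem the trust base of
Rusin–Šverák's Thm. 4.2 in the tree is: the a priori estimate (Cor. 1 = Lemma 4.1), the uniform
attainment of the datum (Lemma 8) and the Kikuchi–Seregin limiting procedure (with Prop. 2.2).
[cite: RusinSverak2011, Thm. 4.2 with Lemma 4.1 and Prop. 2.2 (arXiv:0911.0500 pp. 4, 7)] -/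
theorem rusin_sverak_leray_weak_stability_of_facts (h1 : jia_sverak_2013_corollary_1)
    (h8 : jia_sverak_2013_lemma_8) (hlim : localLeray_limiting_procedure) :
    rusin_sverak_leray_weak_stability :=
  rusin_sverak_leray_weak_stability_of_jia_sverak
    (jia_sverak_leray_weak_stability_of_facts h1 h8 hlim)

/-! ### S, Cor. 4.2 and Cor. 4.3 over K₃ -/

/-- **S (`rusin_sverak_leray_singular_points_stable`, Rusin–Šverák Thm. 4.2 with Lemma 2.1) from
K₃, L and B**: `rusin_sverak_leray_singular_points_stable_of_weak_stability` with **K** supplied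
by `rusin_sverak_leray_weak_stability_of_jia_sverak`.
[cite: RusinSverak2011, Thm. 4.2 with Lemma 2.1, proof of Cor. 4.2 (arXiv:0911.0500 pp. 4, 7–8)] -/
theorem rusin_sverak_leray_singular_points_stable_of_jia_sverak
    (hK₃ : jia_sverak_leray_weak_stability) (hL : rusin_sverak_stability_of_singularities)
    (hB : isRegularPoint_of_eLpNorm_parabolicCylinder_lt_top) :
    rusin_sverak_leray_singular_points_stable :=
  rusin_sverak_leray_singular_points_stable_of_weak_stability
    (rusin_sverak_leray_weak_stability_of_jia_sverak hK₃) hL hB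

/-- **Rusin–Šverák's Cor. 4.2 (`rusin_sverak_weak_limit_of_singular_points`) from E, W, R, K₃, L,
B** (`rusin_sverak_weak_limit_of_singular_points_of_weak_stability` with **K** from **K₃**).
[cite: RusinSverak2011, Cor. 4.2 and its proof (arXiv:0911.0500 p. 8)] -/
theorem rusin_sverak_weak_limit_of_singular_points_of_jia_sverak
    (hE : leray_solution_exists_of_memLp_three) (hW : leray_solution_ae_eq_kato)
    (hR : kato_solution_le_div_sqrt) (hK₃ : jia_sverak_leray_weak_stability)
    (hL : rusin_sverak_stability_of_singularities)
    (hB : isRegularPoint_of_eLpNorm_parabolicCylinder_lt_top) :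
    rusin_sverak_weak_limit_of_singular_points :=
  rusin_sverak_weak_limit_of_singular_points_of_weak_stability hE hW hR
    (rusin_sverak_leray_weak_stability_of_jia_sverak hK₃) hL hB

/-- **Rusin–Šverák, Cor. 4.3, second clause (`rusin_sverak_minimal_data_compact`), over the leaves
`N′`, E, W, R, K₃, L, B, `kato_local`** (`rusin_sverak_minimal_data_compact_of_weak_stability`
with **K** from **K₃**). [cite: RusinSverak2011, Cor. 4.3 (arXiv:0911.0500 p. 8)] -/
theorem rusin_sverak_minimal_data_compact_of_jia_sverak
    (hN' : rusin_sverak_singularity_at_katoMaximalTime) (hE : leray_solution_exists_of_memLp_three)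
    (hW : leray_solution_ae_eq_kato) (hR : kato_solution_le_div_sqrt)
    (hK₃ : jia_sverak_leray_weak_stability) (hL : rusin_sverak_stability_of_singularities)
    (hB : isRegularPoint_of_eLpNorm_parabolicCylinder_lt_top) (hLoc : kato_local) :
    rusin_sverak_minimal_data_compact :=
  rusin_sverak_minimal_data_compact_of_weak_stability hN' hE hW hR
    (rusin_sverak_leray_weak_stability_of_jia_sverak hK₃) hL hB hLoc

/-- **Rusin–Šverák, Cor. 4.3, first clause (`rusin_sverak_minimal_blowup`), over the leaves `N′`,
E, W, R, K₃, L, B, `kato_local`** (`rusin_sverak_minimal_blowup_of_weak_stability` with **K**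
from **K₃**). [cite: RusinSverak2011, Cor. 4.3 (arXiv:0911.0500 p. 8)] -/
theorem rusin_sverak_minimal_blowup_of_jia_sverak
    (hN' : rusin_sverak_singularity_at_katoMaximalTime) (hE : leray_solution_exists_of_memLp_three)
    (hW : leray_solution_ae_eq_kato) (hR : kato_solution_le_div_sqrt)
    (hK₃ : jia_sverak_leray_weak_stability) (hL : rusin_sverak_stability_of_singularities)
    (hB : isRegularPoint_of_eLpNorm_parabolicCylinder_lt_top) (hLoc : kato_local) :
    rusin_sverak_minimal_blowup :=
  rusin_sverak_minimal_blowup_of_weak_stability hN' hE hW hR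
    (rusin_sverak_leray_weak_stability_of_jia_sverak hK₃) hL hB hLoc

end Literature.Analysis.FluidPDE

end
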